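import Summits.QuantumFields.YangMills.Theorems.UnitScaleTiltProp7CurrentSlavingFlat
import HarnessLib

/-!
# Route `UnitScaleTilt`, crux K1 child «MinimiserStabilityRegPr» (stmt-QuantumFields-19200), registered stub `stub_prop7From14` (V3, skeleton v7
# cc37a1787726) — lane B, «the current is slaved to the curvature under the Euler–Lagrange port», LOCAL FORM, flat half: **the normal operator of the
# straight `k`-fold average is tridiagonal ALONG THE AXIS and diagonally dominant with ratio `2γ/α ≤ 1/2`, so a multiplier current at a fine bond is
# controlled by the block averages of the `2R + 2` coarse bonds on its axis line within distance `R + 1`, up to `2^{−(R+1)}` times a global a-priori bound**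

Cell `ym3-torus` ∕ fleet seat `ym-ust-19200-p3` (WIDTH-LEVER lane B of V3; HUMAN RULING D-0037, YM ladder rung R3).  `--supports stmt-QuantumFields-19200
--as helper`.  Sequel of `UnitScaleTiltProp7CurrentSlavingFlat` (p544572); the covariant ∕ carrier local forms are in `UnitScaleTiltProp7CurrentSlavingLocal`.

WHY.  The global form (p545507) asks for `sup‖V − 1‖ ≤ a` over the WHOLE torus — a global near-identity presentation, which a configuration of print's
space (6) need not have (holonomies along the torus cycles).  But `Q_kQ_k^⊤` is the identity transversally and `D(αI + γ(S + S⁻¹))` along the axis with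
`2γ/α = (n² − 1)/(2n² + 1) ≤ 1/2` (`n = L^k`), so by the discrete maximum principle the coarse datum at `c₀` is bounded by the right-hand side on the
`2R + 1` axis neighbours plus `(2γ/α)^{R+1}` times a global bound: local defect + local block averages + global a-priori size ⇒ pointwise bound with an
exponentially small tail (`R ≈ k·log₂L` makes it `O(L^{−k})`).

WHAT IS PROVED (sorry-free, no definition, standard axioms; every torus of `Setup`, `k` in the standing range):
* §1 `six_mul_tent_cross` (`6γ = n³ − n`), `two_mul_tent_cross_le` (`4γ ≤ α`).
* §2 **`tridiag_local_le`**: for `D(αW(c) + γW(c − e_μ) + γW(c + e_μ)) = Z(c)` with `D > 0`, `0 ≤ 2γ < α`: `|W(x₀ + (R+1)e_μ)| ≤ B/(D(α − 2γ)) +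
  (2γ/α)^{R+1}·M` whenever `|Z| ≤ B` at the axis positions `1 … 2R+1` and `|W| ≤ M` everywhere (induction inward from the window's ends).
* §3 `abs_adjField_le_local` (`|Q_k^⊤W(b)| ≤ L^{−kd}·max(|W(c_b)|, |W(c_b − e_μ)|)`), **`abs_bondAvgIter_le_of_transverseDiff_local`** (tent-Stokes with the
  decomposition hypothesis only on the `L^{k(d+1)}` bond visits of the tube of `c`), `abs_bondAvgIter_le_of_tube` (`Q_k` reads only the tube).
* §4 **`abs_le_of_sub_adjField_le_local`**: `|j − Q_k^⊤W| ≤ p` at `b` and on the tubes of the `2R + 2` axis neighbours, `|Q_kj| ≤ B` there, `|Q_k^⊤W| ≤ A_g`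
  everywhere ⇒ `|j(b)| ≤ 3B + 4p + 2^{−(R+1)}·A_g`.
HONEST SCOPE.  Lattice calculus and linear algebra only.  Not a claim about the mass gap.

References: T. Bałaban, CMP **95** (1984) 17–40 [Balaban1984PropagatorsI] ((1.18) p.20); CMP **102** (1985) 277–309 [Balaban1985Variational] ((2) p.278,
(45)–(46) p.285, (133) p.298, (158) p.302).
-/

set_option autoImplicit false

noncomputable section

open scoped BigOperators

namespace Summit.QuantumFields.YangMills.Theorems.Prop7CurrentSlaving

open Literature.MathematicalPhysics.QuantumFieldTheory.Balaban1983to89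
open Finset LatticeFieldCalculus B1RG242Torus
open Summit.QuantumFields.YangMills.Theorems.Prop7FlatCoercivity (iterate_shift_eq_runSite runSite_runSite runSite_apply_self
  runSite_apply_of_ne fibreSite_runSite sum_fibre_eq_sum_offsets bondAvgIter_eq_lineBlockAvg_real sitesPerDir_zero_eq_pow_mul)
open Summit.QuantumFields.YangMills.Theorems.Prop7LineAvgRightInverse (sum_offsets_eq_sum_split card_offsets_reset fibreSite_update
  lineAvg_adjField adjField_abs_le tridiag_pointwise key_dominance tent_gamma_nonneg tent_moments_sub cast_tent)
open Summit.QuantumFields.YangMills.Theorems.Prop7LineAvgAdjoint (abs_le_pow_mul_of_adjField_abs_le)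

variable {P : Params}

/-! ## §1 The off-diagonal tent moment: `6γ = n³ − n`, hence `4γ ≤ α` -/

/-- `6·Σ_{s<n}(s + 1)(n − 1 − s) = n³ − n`. [folklore] -/
theorem six_mul_tent_cross (n : ℕ) :
    6 * ∑ s : Fin n, (((s : ℕ) : ℝ) + 1) * ((n - 1 - (s : ℕ) : ℕ) : ℝ) = (n : ℝ) ^ 3 - n := by
  have e : ∀ s : Fin n, (((s : ℕ) : ℝ) + 1) * ((n - 1 - (s : ℕ) : ℕ) : ℝ) = (((s : ℕ) : ℝ) + 1) * ((n : ℝ) - 1 - (s : ℕ)) := by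
    intro s; rw [cast_tent]
  rw [Finset.sum_congr rfl (fun s _ => e s), Finset.sum_fin_eq_sum_range]
  -- a cleaner range form
  have h1 : ∑ i ∈ range n, (if h : i < n then ((((⟨i, h⟩ : Fin n) : ℕ) : ℝ) + 1) * ((n : ℝ) - 1 - (((⟨i, h⟩ : Fin n) : ℕ) : ℕ)) else 0)
      = ∑ i ∈ range n, (((i : ℝ) + 1) * ((n : ℝ) - 1 - i)) := by
    refine Finset.sum_congr rfl fun i hi => ?_
    rw [Finset.mem_range] at hi
    rw [dif_pos hi]
  rw [h1]
  -- Gauss sums inlined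
  have S1 : ∀ m : ℕ, ∑ s ∈ range m, ((s : ℝ) + 1) = (m : ℝ) * (m + 1) / 2 := by
    intro m
    induction m with
    | zero => simp
    | succ m ih => rw [Finset.sum_range_succ, ih]; push_cast; ring
  have S2 : ∀ m : ℕ, ∑ s ∈ range m, ((s : ℝ) + 1) ^ 2 = (m : ℝ) * (m + 1) * (2 * m + 1) / 6 := by
    intro m
    induction m with
    | zero => simp
    | succ m ih => rw [Finset.sum_range_succ, ih]; push_cast; ring
  have e2 : ∀ i ∈ range n, ((i : ℝ) + 1) * ((n : ℝ) - 1 - i) = (n : ℝ) * ((i : ℝ) + 1) - ((i : ℝ) + 1) ^ 2 := fun i _ => by ring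
  rw [Finset.sum_congr rfl e2, Finset.sum_sub_distrib, ← Finset.mul_sum, S1, S2]
  ring

/-- **`4γ ≤ α`**: the off-diagonal ratio of the normal operator is at most `1/2` (`α = (2n³ + n)/3`, `2γ = (n³ − n)/3`). [folklore] -/
theorem two_mul_tent_cross_le (n : ℕ) :
    4 * ∑ s : Fin n, (((s : ℕ) : ℝ) + 1) * ((n - 1 - (s : ℕ) : ℕ) : ℝ)
      ≤ ∑ s : Fin n, ((((s : ℕ) : ℝ) + 1) ^ 2 + (((n - 1 - (s : ℕ) : ℕ) : ℝ)) ^ 2) := by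
  have h1 := tent_moments_sub n
  have h2 := six_mul_tent_cross n
  have hn : (0 : ℝ) ≤ n := Nat.cast_nonneg n
  nlinarith

/-! ## §2 The discrete maximum principle along the axis -/
section MaxPrinciple
variable {j : ℕ}

/-- Stepping back from the `(s+1)`-th axis position lands on the `s`-th. [folklore] -/
theorem unshift_runSite_succ (x : Site P j) (μ : Fin P.d) (s : ℕ) : (runSite x μ (s + 1)).unshift μ = runSite x μ s := by
  rw [unshift_runSite_comm, runSite_unshift_succ]

/-- **DISCRETE MAXIMUM PRINCIPLE FOR THE TRIDIAGONAL NORMAL OPERATOR**: if `D(αW(c) + γW(c − e_μ) + γW(c + e_μ)) = Z(c)` at every coarse bond, `D > 0`,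
`0 ≤ γ`, `2γ < α`, `|Z| ≤ B` at the axis positions `x₀ + s·e_μ`, `1 ≤ s ≤ 2R + 1`, and `|W| ≤ M` everywhere, then at the centre
`|W(x₀ + (R+1)e_μ)| ≤ B/(D(α − 2γ)) + (2γ/α)^{R+1}·M` (induction inward from the window's ends). [folklore] -/
theorem tridiag_local_le (D α γ : ℝ) (W Z : PBond P j → ℝ) (hD : 0 < D) (hγ : 0 ≤ γ) (hαγ : 2 * γ < α)
    (hT : ∀ c : PBond P j, D * (α * W c + γ * W ⟨c.src.unshift c.dir, c.dir⟩ + γ * W ⟨runSite c.src c.dir 1, c.dir⟩) = Z c)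
    (x₀ : Site P j) (μ : Fin P.d) (R : ℕ) {B M : ℝ}
    (hnear : ∀ s : ℕ, 1 ≤ s → s ≤ 2 * R + 1 → |Z ⟨runSite x₀ μ s, μ⟩| ≤ B) (hfar : ∀ c : PBond P j, |W c| ≤ M) :
    |W ⟨runSite x₀ μ (R + 1), μ⟩| ≤ B / (D * (α - 2 * γ)) + (2 * γ / α) ^ (R + 1) * M := by
  have hα : 0 < α := by linarith
  have hB : 0 ≤ B := (abs_nonneg _).trans (hnear 1 le_rfl (by omega))
  have hM : 0 ≤ M := (abs_nonneg _).trans (hfar ⟨x₀, μ⟩)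
  set θ : ℝ := 2 * γ / α with hθ
  have hθ0 : 0 ≤ θ := by positivity
  have hθ1 : θ < 1 := by rw [hθ, div_lt_one hα]; exact hαγ
  -- induction inward: after `i` steps the window `[i, 2R+2−i]` obeys the bound with `i` geometric terms
  have step : ∀ i : ℕ, i ≤ R + 1 → ∀ s : ℕ, i ≤ s → s + i ≤ 2 * R + 2 →
      |W ⟨runSite x₀ μ s, μ⟩| ≤ B / (D * α) * (∑ l ∈ range i, θ ^ l) + θ ^ i * M := by
    intro i
    induction i with
    | zero =>
      intro _ s _ _
      simpa using hfar ⟨runSite x₀ μ s, μ⟩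
    | succ i ih =>
      intro hi s hs hsi
      have ih' := ih (Nat.le_of_succ_le hi)
      have hs1 : 1 ≤ s := by omega
      -- the equation at the axis position `s`, neighbours at `s − 1` and `s + 1`
      have hp := tridiag_pointwise D α γ W Z hD.le hγ hT ⟨runSite x₀ μ s, μ⟩
      have e1 : (⟨(runSite x₀ μ s).unshift μ, μ⟩ : PBond P j) = ⟨runSite x₀ μ (s - 1), μ⟩ := by
        obtain ⟨t, rfl⟩ : ∃ t, s = t + 1 := ⟨s - 1, by omega⟩
        rw [unshift_runSite_succ, Nat.add_sub_cancel]
      have e2 : (⟨runSite (runSite x₀ μ s) μ 1, μ⟩ : PBond P j) = ⟨runSite x₀ μ (s + 1), μ⟩ := by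
        rw [runSite_runSite]
      simp only [e1, e2] at hp
      have hZ := hnear s hs1 (by omega)
      have hm := ih' (s - 1) (by omega) (by omega)
      have hp' := ih' (s + 1) (by omega) (by omega)
      -- divide by `Dα`
      have hDα : 0 < D * α := mul_pos hD hα
      set Q : ℝ := B / (D * α) * (∑ l ∈ range i, θ ^ l) + θ ^ i * M with hQ
      have key : D * α * |W ⟨runSite x₀ μ s, μ⟩| ≤ B + D * γ * (2 * Q) := by
        nlinarith [mul_nonneg hD.le hγ]
      have hdiv0 : |W ⟨runSite x₀ μ s, μ⟩| ≤ (B + D * γ * (2 * Q)) / (D * α) := by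
        rw [le_div_iff₀ hDα]; linarith
      have hdiv : |W ⟨runSite x₀ μ s, μ⟩| ≤ B / (D * α) + θ * Q := by
        refine hdiv0.trans (le_of_eq ?_)
        rw [hθ]
        field_simp
      refine hdiv.trans (le_of_eq ?_)
      rw [hQ, Finset.sum_range_succ', pow_zero]
      simp only [pow_succ']
      rw [← Finset.mul_sum]
      ring
  have h := step (R + 1) le_rfl (R + 1) le_rfl (by omega)
  -- the geometric sum is at most `1/(1 − θ)`
  have hgeom : (∑ l ∈ range (R + 1), θ ^ l) ≤ 1 / (1 - θ) := by
    have hg := geom_sum_mul_neg θ (R + 1)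
    have h1θ : 0 < 1 - θ := by linarith
    rw [le_div_iff₀ h1θ, hg]
    have : 0 ≤ θ ^ (R + 1) := pow_nonneg hθ0 _
    linarith
  have hcoef : 0 ≤ B / (D * α) := div_nonneg hB (mul_pos hD hα).le
  calc |W ⟨runSite x₀ μ (R + 1), μ⟩| ≤ B / (D * α) * (∑ l ∈ range (R + 1), θ ^ l) + θ ^ (R + 1) * M := h
    _ ≤ B / (D * α) * (1 / (1 - θ)) + θ ^ (R + 1) * M := by
        refine add_le_add (mul_le_mul_of_nonneg_left hgeom hcoef) le_rfl
    _ = B / (D * (α - 2 * γ)) + (2 * γ / α) ^ (R + 1) * M := by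
        rw [hθ]
        have hα2 : α - 2 * γ ≠ 0 := by linarith
        field_simp

end MaxPrinciple

/-! ## §3 Local forms of the tent-field bound and of the tent-Stokes bound -/
section LocalBounds
variable {k : ℕ}

/-- **LOCAL SUP BOUND OF THE TENT FIELD**: `|A(b)| ≤ (L^k)^{−d}·max(|W(c_b)|, |W(c_b − e_μ)|)`, `c_b` the coarse bond of `b` (the two tent weights at a
bond add up to `L^k`). [folklore] -/
theorem abs_adjField_le_local (W : PBond P k → ℝ) (A : PBond P 0 → ℝ)
    (hA : ∀ b : PBond P 0, A b = (((P.L : ℝ) ^ k) ^ P.d * (P.L : ℝ) ^ k)⁻¹ *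
        (((((b.src b.dir).val % P.L ^ k : ℕ) : ℝ) + 1) * W ⟨Site.proj k k b.src, b.dir⟩
          + ((P.L ^ k - 1 - (b.src b.dir).val % P.L ^ k : ℕ) : ℝ) * W ⟨(Site.proj k k b.src).unshift b.dir, b.dir⟩))
    (b : PBond P 0) :
    |A b| ≤ (((P.L : ℝ) ^ k) ^ P.d)⁻¹ * max |W ⟨Site.proj k k b.src, b.dir⟩| |W ⟨(Site.proj k k b.src).unshift b.dir, b.dir⟩| := by
  set B : ℝ := max |W ⟨Site.proj k k b.src, b.dir⟩| |W ⟨(Site.proj k k b.src).unshift b.dir, b.dir⟩| with hBdef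
  have hN : (0 : ℝ) < (P.L : ℝ) ^ k := pow_pos (by exact_mod_cast P.L_pos) k
  have hs : (b.src b.dir).val % P.L ^ k < P.L ^ k := Nat.mod_lt _ (pow_pos P.L_pos k)
  have hsum : ((((b.src b.dir).val % P.L ^ k : ℕ) : ℝ) + 1) + ((P.L ^ k - 1 - (b.src b.dir).val % P.L ^ k : ℕ) : ℝ) = (P.L : ℝ) ^ k := by
    have : (b.src b.dir).val % P.L ^ k + 1 + (P.L ^ k - 1 - (b.src b.dir).val % P.L ^ k) = P.L ^ k := by omega
    have := congrArg (fun m : ℕ => (m : ℝ)) this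
    push_cast at this
    linarith
  have ha0 : (0 : ℝ) ≤ (((b.src b.dir).val % P.L ^ k : ℕ) : ℝ) + 1 := by positivity
  have hb0 : (0 : ℝ) ≤ ((P.L ^ k - 1 - (b.src b.dir).val % P.L ^ k : ℕ) : ℝ) := by positivity
  have hC0 : (0 : ℝ) ≤ (((P.L : ℝ) ^ k) ^ P.d * (P.L : ℝ) ^ k)⁻¹ := by positivity
  rw [hA, abs_mul, abs_of_nonneg hC0]
  have h1 : |W ⟨Site.proj k k b.src, b.dir⟩| ≤ B := le_max_left _ _
  have h2 : |W ⟨(Site.proj k k b.src).unshift b.dir, b.dir⟩| ≤ B := le_max_right _ _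
  have h3 : |((((b.src b.dir).val % P.L ^ k : ℕ) : ℝ) + 1) * W ⟨Site.proj k k b.src, b.dir⟩
      + ((P.L ^ k - 1 - (b.src b.dir).val % P.L ^ k : ℕ) : ℝ) * W ⟨(Site.proj k k b.src).unshift b.dir, b.dir⟩|
      ≤ (P.L : ℝ) ^ k * B := by
    refine (abs_add_le _ _).trans ?_
    rw [abs_mul, abs_mul, abs_of_nonneg ha0, abs_of_nonneg hb0, ← hsum]
    nlinarith [mul_le_mul_of_nonneg_left h1 ha0, mul_le_mul_of_nonneg_left h2 hb0]
  calc (((P.L : ℝ) ^ k) ^ P.d * (P.L : ℝ) ^ k)⁻¹ * |((((b.src b.dir).val % P.L ^ k : ℕ) : ℝ) + 1) * W ⟨Site.proj k k b.src, b.dir⟩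
        + ((P.L ^ k - 1 - (b.src b.dir).val % P.L ^ k : ℕ) : ℝ) * W ⟨(Site.proj k k b.src).unshift b.dir, b.dir⟩|
      ≤ (((P.L : ℝ) ^ k) ^ P.d * (P.L : ℝ) ^ k)⁻¹ * ((P.L : ℝ) ^ k * B) := mul_le_mul_of_nonneg_left h3 hC0
    _ = (((P.L : ℝ) ^ k) ^ P.d)⁻¹ * B := by field_simp

/-- **THE TUBE-LOCAL TENT–STOKES BOUND**: as `abs_bondAvgIter_le_of_transverseDiff`, but the decomposition of the `μ`-components into transverse
differences is required only on the `L^{k(d+1)}` bond visits of the tube of `c` (the sites `x_r + t·e_μ`, `x_r ∈ B^k(c₋)`, `t < L^k`).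
[cite: Balaban1984PropagatorsI, (1.18) p.20] -/
theorem abs_bondAvgIter_le_of_transverseDiff_local (hk : k ≤ P.m + P.K) (X : VecField P 0 ℝ) (c : PBond P k) (S : Finset (Fin P.d))
    (g : Fin P.d → Site P 0 → ℝ) {G E : ℝ} (hG : ∀ ν x, |g ν x| ≤ G)
    (hX : ∀ (r : Fin P.d → Fin (P.L ^ k)) (t : ℕ), t < P.L ^ k →
      |X ⟨runSite (Site.fibreSite 0 k c.src r) c.dir t, c.dir⟩
        - ∑ ν ∈ S, (g ν ((runSite (Site.fibreSite 0 k c.src r) c.dir t).unshift ν) - g ν (runSite (Site.fibreSite 0 k c.src r) c.dir t))| ≤ E) :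
    |bondAvgIter k X c| ≤ 2 * S.card * ((P.L : ℝ) ^ k)⁻¹ * G + E := by
  have h := sitesPerDir_zero_eq_pow_mul hk
  have hn : (0 : ℝ) < (P.L : ℝ) ^ k := pow_pos (by exact_mod_cast P.L_pos) k
  have hE : 0 ≤ E := (abs_nonneg _).trans (hX (fun _ => ⟨0, pow_pos P.L_pos k⟩) 0 (pow_pos P.L_pos k))
  have hG0 : 0 ≤ G := (abs_nonneg _).trans (hG ⟨0, P.hd⟩ (Site.fibreSite 0 k c.src fun _ => ⟨0, pow_pos P.L_pos k⟩))
  have hcast : ((P.L ^ k : ℕ) : ℝ) = (P.L : ℝ) ^ k := by push_cast; ring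
  -- the remainder
  set R : Site P 0 → ℝ := fun x => X ⟨x, c.dir⟩ - ∑ ν ∈ S, (g ν (x.unshift ν) - g ν x) with hR
  have hXdec : ∀ x, X ⟨x, c.dir⟩ = (∑ ν ∈ S, (g ν (x.unshift ν) - g ν x)) + R x := fun x => by simp only [hR]; ring
  rw [bondAvgIter_eq_lineBlockAvg_real hk X c]
  simp only [iterate_shift_eq_runSite]
  rw [sum_fibre_eq_sum_offsets h]
  simp only [hXdec, Finset.sum_add_distrib]
  -- the telescoping part
  have hD : |∑ r : Fin P.d → Fin (P.L ^ k), ∑ t ∈ range (P.L ^ k), ∑ ν ∈ S,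
        (g ν ((runSite (Site.fibreSite 0 k c.src r) c.dir t).unshift ν) - g ν (runSite (Site.fibreSite 0 k c.src r) c.dir t))|
      ≤ (P.L ^ k : ℕ) * (S.card * (2 * (((P.L ^ k : ℕ) : ℝ) ^ (P.d - 1)) * G)) := by
    rw [Finset.sum_comm]
    refine (Finset.abs_sum_le_sum_abs _ _).trans ?_
    refine (Finset.sum_le_sum fun t _ => ?_).trans (by rw [Finset.sum_const, Finset.card_range, nsmul_eq_mul])
    rw [Finset.sum_comm]
    refine (Finset.abs_sum_le_sum_abs _ _).trans ?_
    refine (Finset.sum_le_sum fun ν _ => ?_).trans (by rw [Finset.sum_const, nsmul_eq_mul])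
    exact abs_sum_offsets_transverseDiff_runSite_le c.src c.dir ν t (g ν) (hG ν)
  -- the remainder part, from the tube-local hypothesis
  have hRsum : |∑ r : Fin P.d → Fin (P.L ^ k), ∑ t ∈ range (P.L ^ k), R (runSite (Site.fibreSite 0 k c.src r) c.dir t)|
      ≤ ((P.L : ℝ) ^ k) ^ P.d * ((P.L : ℝ) ^ k * E) := by
    have hcard : ((Finset.univ : Finset (Fin P.d → Fin (P.L ^ k))).card : ℝ) = ((P.L : ℝ) ^ k) ^ P.d := by
      rw [Finset.card_univ, Fintype.card_fun, Fintype.card_fin, Fintype.card_fin]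
      push_cast
      ring
    have hinner : ∀ r : Fin P.d → Fin (P.L ^ k),
        |∑ t ∈ range (P.L ^ k), R (runSite (Site.fibreSite 0 k c.src r) c.dir t)| ≤ (P.L : ℝ) ^ k * E := by
      intro r
      refine (Finset.abs_sum_le_sum_abs _ _).trans ?_
      refine (Finset.sum_le_sum fun t ht => hX r t (Finset.mem_range.1 ht)).trans ?_
      rw [Finset.sum_const, Finset.card_range, nsmul_eq_mul]
      push_cast
      exact le_rfl
    refine (Finset.abs_sum_le_sum_abs _ _).trans ?_
    refine (Finset.sum_le_sum fun r _ => hinner r).trans ?_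
    rw [Finset.sum_const, nsmul_eq_mul, hcard]
  rw [hcast] at hD
  set n : ℝ := (P.L : ℝ) ^ k with hndef
  set m : ℝ := n ^ (P.d - 1) with hmdef
  have hdpow : n ^ P.d = m * n := by
    rw [hmdef, ← pow_succ, Nat.sub_add_cancel P.hd]
  rw [hdpow] at hRsum ⊢
  have hm0 : 0 < m := pow_pos hn _
  have hC0 : (0 : ℝ) ≤ (m * n * n)⁻¹ := by positivity
  have hmn : m * n ≠ 0 := by positivity
  have hmnn : m * n * n ≠ 0 := by positivity
  rw [abs_mul, abs_of_nonneg hC0]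
  calc (m * n * n)⁻¹ *
        |∑ r : Fin P.d → Fin (P.L ^ k), ∑ t ∈ range (P.L ^ k), ∑ ν ∈ S,
            (g ν ((runSite (Site.fibreSite 0 k c.src r) c.dir t).unshift ν) - g ν (runSite (Site.fibreSite 0 k c.src r) c.dir t))
          + ∑ r : Fin P.d → Fin (P.L ^ k), ∑ t ∈ range (P.L ^ k), R (runSite (Site.fibreSite 0 k c.src r) c.dir t)|
      ≤ (m * n * n)⁻¹ * (n * (S.card * (2 * m * G)) + m * n * (n * E)) :=
        mul_le_mul_of_nonneg_left ((abs_add_le _ _).trans (add_le_add hD hRsum)) hC0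
    _ = 2 * S.card * n⁻¹ * G + E := by
        have h1 : (m * n * n)⁻¹ * (m * n) = n⁻¹ := by
          rw [mul_inv, mul_comm (m * n)⁻¹, mul_assoc, inv_mul_cancel₀ hmn, mul_one]
        rw [show n * (S.card * (2 * m * G)) + m * n * (n * E) = (m * n * n) * E + (m * n) * (2 * S.card * G) by ring,
          mul_add, ← mul_assoc, inv_mul_cancel₀ hmnn, one_mul, ← mul_assoc, h1]
        ring

/-- The block average reads only the tube: a field bounded by `p` on the tube of `c` has `|(Q_kX)(c)| ≤ p`. [cite: Balaban1984PropagatorsI, (1.18) p.20] -/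
theorem abs_bondAvgIter_le_of_tube (hk : k ≤ P.m + P.K) (X : VecField P 0 ℝ) (c : PBond P k) {p : ℝ}
    (hX : ∀ (r : Fin P.d → Fin (P.L ^ k)) (t : ℕ), t < P.L ^ k → |X ⟨runSite (Site.fibreSite 0 k c.src r) c.dir t, c.dir⟩| ≤ p) :
    |bondAvgIter k X c| ≤ p := by
  have h := abs_bondAvgIter_le_of_transverseDiff_local hk X c ∅ (fun _ _ => 0) (G := 0) (E := p)
    (fun _ _ => by simp) (fun r t ht => by simpa using hX r t ht)
  simpa using h

end LocalBounds

/-! ## §4 The local form of «a multiplier current is bounded by its block averages» -/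
section LocalRange
variable {k : ℕ}

/-- **LOCAL SLAVING, ABSTRACT FORM.**  Let `A = Q_k^⊤W` (tent field), `b` a fine bond with coarse bond `c_b = ⟨x₀ + (R+2)e_μ, μ⟩` on the axis line from
`x₀`, and `j` a fine field with: defect `|j − A| ≤ p` at `b` and on the tubes of the axis neighbours `c_s = ⟨x₀ + s·e_μ, μ⟩`, `1 ≤ s ≤ 2R + 2`; block
averages `|(Q_kj)(c_s)| ≤ B` there; and a global a-priori bound `|A| ≤ A_g`.  Then `|j(b)| ≤ 3B + 4p + 2^{−(R+1)}·A_g`.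
[cite: Balaban1985Variational, (133) p.298, (158) p.302; Balaban1984PropagatorsI, (1.18) p.20] -/
theorem abs_le_of_sub_adjField_le_local (hk : k ≤ P.m + P.K) (W : PBond P k → ℝ) (A : PBond P 0 → ℝ)
    (hA : ∀ b : PBond P 0, A b = (((P.L : ℝ) ^ k) ^ P.d * (P.L : ℝ) ^ k)⁻¹ *
        (((((b.src b.dir).val % P.L ^ k : ℕ) : ℝ) + 1) * W ⟨Site.proj k k b.src, b.dir⟩
          + ((P.L ^ k - 1 - (b.src b.dir).val % P.L ^ k : ℕ) : ℝ) * W ⟨(Site.proj k k b.src).unshift b.dir, b.dir⟩))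
    (j : PBond P 0 → ℝ) (b : PBond P 0) (x₀ : Site P k) (R : ℕ) (hb : Site.proj k k b.src = runSite x₀ b.dir (R + 2))
    {p B Ag : ℝ} (hjb : |j b - A b| ≤ p)
    (hjA : ∀ (s : ℕ), 1 ≤ s → s ≤ 2 * R + 2 → ∀ (r : Fin P.d → Fin (P.L ^ k)) (t : ℕ), t < P.L ^ k →
      |j ⟨runSite (Site.fibreSite 0 k (runSite x₀ b.dir s) r) b.dir t, b.dir⟩ - A ⟨runSite (Site.fibreSite 0 k (runSite x₀ b.dir s) r) b.dir t, b.dir⟩| ≤ p)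
    (hM : ∀ (s : ℕ), 1 ≤ s → s ≤ 2 * R + 2 → |bondAvgIter k j ⟨runSite x₀ b.dir s, b.dir⟩| ≤ B)
    (hAg : ∀ b' : PBond P 0, |A b'| ≤ Ag) :
    |j b| ≤ 3 * B + 4 * p + (1 / 2) ^ (R + 1) * Ag := by
  have h := sitesPerDir_zero_eq_pow_mul hk
  have hN : (0 : ℝ) < (P.L : ℝ) ^ k := pow_pos (by exact_mod_cast P.L_pos) k
  have hAg0 : 0 ≤ Ag := (abs_nonneg _).trans (hAg b)
  have hp0 : 0 ≤ p := (abs_nonneg _).trans hjb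
  set μ : Fin P.d := b.dir with hμ
  -- the normal operator, as in `abs_adjField_le_of_bondAvgIter`
  let α : ℝ := ∑ s : Fin (P.L ^ k), ((((s : ℕ) : ℝ) + 1) ^ 2 + (((P.L ^ k - 1 - (s : ℕ) : ℕ) : ℝ)) ^ 2)
  let γ : ℝ := ∑ s : Fin (P.L ^ k), (((s : ℕ) : ℝ) + 1) * ((P.L ^ k - 1 - (s : ℕ) : ℕ) : ℝ)
  let D : ℝ := (((P.L : ℝ) ^ k) ^ P.d * (P.L : ℝ) ^ k)⁻¹ * ((((P.L ^ k : ℕ) : ℝ) ^ (P.d - 1)) *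
      (((P.L : ℝ) ^ k) ^ P.d * (P.L : ℝ) ^ k)⁻¹)
  have hPLk : (0 : ℝ) < ((P.L ^ k : ℕ) : ℝ) := by exact_mod_cast pow_pos P.L_pos k
  have hD : 0 < D := mul_pos (by positivity) (mul_pos (pow_pos hPLk _) (by positivity))
  have hγ : 0 ≤ γ := tent_gamma_nonneg _
  have key : 1 ≤ 3 * ((P.L : ℝ) ^ k) ^ P.d * (D * (α - 2 * γ)) := key_dominance P k
  have hαγ' : α - 2 * γ = (((P.L ^ k : ℕ) : ℝ) ^ 3 + 2 * ((P.L ^ k : ℕ) : ℝ)) / 3 := tent_moments_sub (P.L ^ k)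
  have h4γ : 4 * γ ≤ α := two_mul_tent_cross_le (P.L ^ k)
  have hn1 : (1 : ℝ) ≤ ((P.L ^ k : ℕ) : ℝ) := by exact_mod_cast Nat.one_le_pow _ _ P.L_pos
  have hαγ : 2 * γ < α := by
    have : 0 < α - 2 * γ := by rw [hαγ']; positivity
    linarith
  have hα : 0 < α := by linarith
  have hθ : 2 * γ / α ≤ 1 / 2 := by
    rw [div_le_iff₀ hα]; linarith
  have hθ0 : 0 ≤ 2 * γ / α := by positivity
  -- `Q_kA = TW`
  have hT : ∀ c : PBond P k, D * (α * W c + γ * W ⟨c.src.unshift c.dir, c.dir⟩ + γ * W ⟨runSite c.src c.dir 1, c.dir⟩)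
      = bondAvgIter k A c := by
    intro c
    rw [bondAvgIter_eq_lineBlockAvg_real hk A c, lineAvg_adjField h W A hA c]
    ring
  -- near: `|Q_kA(c_s)| ≤ B + p`
  have hnear : ∀ s : ℕ, 1 ≤ s → s ≤ 2 * R + 2 → |bondAvgIter k A ⟨runSite x₀ μ s, μ⟩| ≤ B + p := by
    intro s hs1 hs2
    have hAe : A = j - (fun b' => j b' - A b') := by funext b'; simp
    have e : bondAvgIter k A ⟨runSite x₀ μ s, μ⟩
        = bondAvgIter k j ⟨runSite x₀ μ s, μ⟩ - bondAvgIter k (fun b' => j b' - A b') ⟨runSite x₀ μ s, μ⟩ := by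
      conv_lhs => rw [hAe]
      rw [← B6SectAOntoV1.bondAvgIterLin_apply, map_sub]
      rfl
    rw [e]
    have h2 := abs_bondAvgIter_le_of_tube hk (fun b' => j b' - A b') ⟨runSite x₀ μ s, μ⟩ (p := p)
      (fun r t ht => hjA s hs1 hs2 r t ht)
    exact (abs_sub _ _).trans (add_le_add (hM s hs1 hs2) h2)
  -- far: `|W| ≤ L^{kd}·A_g`
  have hfar : ∀ c : PBond P k, |W c| ≤ ((P.L : ℝ) ^ k) ^ P.d * Ag := fun c => abs_le_pow_mul_of_adjField_abs_le h W A hA hAg c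
  -- the maximum principle at the two coarse bonds of `b`
  have hW1 : |W ⟨runSite x₀ μ (R + 1), μ⟩| ≤ (B + p) / (D * (α - 2 * γ)) + (2 * γ / α) ^ (R + 1) * (((P.L : ℝ) ^ k) ^ P.d * Ag) :=
    tridiag_local_le D α γ W (bondAvgIter k A) hD hγ hαγ hT x₀ μ R (fun s hs1 hs2 => hnear s hs1 (by omega)) hfar
  have hW2 : |W ⟨runSite x₀ μ (R + 2), μ⟩| ≤ (B + p) / (D * (α - 2 * γ)) + (2 * γ / α) ^ (R + 1) * (((P.L : ℝ) ^ k) ^ P.d * Ag) := by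
    have h' := tridiag_local_le D α γ W (bondAvgIter k A) hD hγ hαγ hT (runSite x₀ μ 1) μ R
      (fun s hs1 hs2 => by rw [runSite_runSite]; exact hnear (1 + s) (by omega) (by omega)) hfar
    rwa [runSite_runSite, show 1 + (R + 1) = R + 2 by ring] at h'
  -- the tent field at `b`
  have hAb := abs_adjField_le_local W A hA b
  have hc1 : (⟨Site.proj k k b.src, b.dir⟩ : PBond P k) = ⟨runSite x₀ μ (R + 2), μ⟩ := by rw [hb]
  have hc2 : (⟨(Site.proj k k b.src).unshift b.dir, b.dir⟩ : PBond P k) = ⟨runSite x₀ μ (R + 1), μ⟩ := by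
    rw [hb, show R + 2 = (R + 1) + 1 by ring, unshift_runSite_succ]
  rw [hc1, hc2] at hAb
  have hmax : max |W ⟨runSite x₀ μ (R + 2), μ⟩| |W ⟨runSite x₀ μ (R + 1), μ⟩|
      ≤ (B + p) / (D * (α - 2 * γ)) + (2 * γ / α) ^ (R + 1) * (((P.L : ℝ) ^ k) ^ P.d * Ag) := max_le hW2 hW1
  -- the constants: `(L^{kd})⁻¹/(D(α − 2γ)) ≤ 3` and `(2γ/α)^{R+1} ≤ 2^{−(R+1)}`
  have hDαγ : 0 < D * (α - 2 * γ) := mul_pos hD (by linarith)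
  have hinv : (((P.L : ℝ) ^ k) ^ P.d)⁻¹ * ((B + p) / (D * (α - 2 * γ))) ≤ 3 * (B + p) := by
    have hBp : 0 ≤ B + p := by
      have := hnear 1 le_rfl (by omega)
      exact (abs_nonneg _).trans this
    rw [inv_mul_le_iff₀ (by positivity : (0 : ℝ) < ((P.L : ℝ) ^ k) ^ P.d), div_le_iff₀ hDαγ]
    nlinarith [key, hBp]
  have hpow : (2 * γ / α) ^ (R + 1) ≤ (1 / 2) ^ (R + 1) := pow_le_pow_left₀ hθ0 hθ _
  have htail : (((P.L : ℝ) ^ k) ^ P.d)⁻¹ * ((2 * γ / α) ^ (R + 1) * (((P.L : ℝ) ^ k) ^ P.d * Ag)) ≤ (1 / 2) ^ (R + 1) * Ag := by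
    have e : (((P.L : ℝ) ^ k) ^ P.d)⁻¹ * ((2 * γ / α) ^ (R + 1) * (((P.L : ℝ) ^ k) ^ P.d * Ag)) = (2 * γ / α) ^ (R + 1) * Ag := by
      field_simp
    rw [e]
    exact mul_le_mul_of_nonneg_right hpow hAg0
  have hAb' : |A b| ≤ 3 * (B + p) + (1 / 2) ^ (R + 1) * Ag := by
    refine hAb.trans ?_
    refine (mul_le_mul_of_nonneg_left hmax (by positivity)).trans ?_
    rw [mul_add]
    exact add_le_add hinv htail
  have h3 : |j b| ≤ |j b - A b| + |A b| := by
    have := abs_add_le (j b - A b) (A b); rwa [sub_add_cancel] at this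
  linarith

end LocalRange

end Summit.QuantumFields.YangMills.Theorems.Prop7CurrentSlaving

end
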